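import Mathlib.CategoryTheory.Endomorphism
import Mathlib.CategoryTheory.Conj
import Literature.AnabelianGeometry.SemiGraphs.TemperoidsGaloisObjectsProofs
import Literature.AnabelianGeometry.SemiGraphs.TemperoidsCountablyConnectedTransport
import Literature.AnabelianGeometry.SemiGraphs.TemperedResiduallyFiniteProofs
import Literature.AnabelianGeometry.EtaleTheta.Discharge.Sec2ProfiniteCompletion
import HarnessLib

/-!
# [SemiAnbd] Prop. 3.6 (iii): transport through the chart `B^temp(G) ≌ B^temp(π₁^temp(G))`

Proof-only companion (abc-iut cell, layer L3, G10 rung 2, node SemiAnbd:Prop3.6(iii)), second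
part.  Mochizuki, *Semi-graphs of anabelioids*, Publ. RIMS 42 (2006), p. 39: `π₁^temp(G)` is the
inverse limit of the Galois groups `Gal(H'_i/G)` of the cofinal system of Galois tempered coverings
`H'_i` = (finite étale Galois) ∘ (universal graph-covering), each an extension of a finite group by
a free group, hence residually finite.  Here we reduce the named fact `TemperedPiResiduallyFinite`
(for an ARBITRARY chart `c : TemperedPiChart 𝒢`, i.e. any tempered `Π` with
`B^temp(𝒢) ≌ B^temp(Π)`) to a statement living entirely inside the category `B^temp(𝒢)`:

  (GalDom) every connected tempered covering `S` of `𝒢` receives a morphism from a Galois object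
  `H` of `B^temp(𝒢)` whose automorphism group `Aut H` is residually finite

(`temperedPiResiduallyFinite_of_galoisDomination`).  The transport: `Π/N₀ ∈ B^temp(Π)` corresponds
to a connected `S₀`; a Galois `H → S₀` corresponds to a Galois `Y → Π/N₀`, and Galois objects of
`B^temp(Π)` are the `Π/N`, `N` open normal (Rmk. 3.1.3, `GaloisObjIffQuotientOpenNormal_holds`);
the morphism forces `N ≤ N₀`, and `Π/N ↪ Aut(Π/N)ᵒᵖ ≅ Aut(Y)ᵒᵖ ≅ Aut(H)ᵒᵖ` is residually
finite.  (GalDom) itself — the construction of the `H'_i` and of their deck groups — is G10 rung 1.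
No new definitions; nothing here concerns the disputed parts of the corpus.
-/

open CategoryTheory CategoryTheory.Limits Topology

namespace Literature.AnabelianGeometry.SemiGraphs

open Literature.AlgebraicGeometry.Frobenioids (IsConnectedObj IsNonemptyObj)
open Literature.AlgebraicGeometry.Frobenioids.QuasiTemperoid.BTempConnected
open Literature.AnabelianGeometry.EtaleTheta.DiscreteNormalizers (residuallyFinite_of_mulEquiv)
open GaloisObjects TemperoidTransport

universe v v' u u'

/-! ### Galois objects are transported by equivalences of categories -/

section Transport

variable {C : Type u} [Category.{v} C] {D : Type u'} [Category.{v'} D]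

/-- **Galois objects (Def. 3.1 (iv)) are preserved by an equivalence of categories**: the notion
is intrinsic (connectedness + transitivity of `Aut` on arrows from connected objects).
[cite: MochizukiSemiAnbd2006, Def 3.1(iv) p.33] -/
theorem isGaloisObj_functor_obj (e : C ≌ D) {A : C} (h : IsGaloisObj A) :
    IsGaloisObj (e.functor.obj A) := by
  refine ⟨isConnectedObj_functor_obj e h.1, fun S hS ψ₁ ψ₂ => ?_⟩
  -- transpose the two arrows along the adjunction `e.inverse ⊣ e.functor`
  let adj := e.symm.toAdjunction
  have hS' : IsConnectedObj (e.inverse.obj S) := isConnectedObj_functor_obj e.symm hS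
  obtain ⟨α, hα⟩ := h.2 (e.inverse.obj S) hS'
    ((adj.homEquiv S A).symm ψ₁) ((adj.homEquiv S A).symm ψ₂)
  refine ⟨e.functor.mapIso α, ?_⟩
  have h1 : adj.homEquiv S A ((adj.homEquiv S A).symm ψ₁) = ψ₁ := Equiv.apply_symm_apply _ _
  have h2 : adj.homEquiv S A ((adj.homEquiv S A).symm ψ₂) = ψ₂ := Equiv.apply_symm_apply _ _
  have h3 := congrArg (adj.homEquiv S A) hα
  have h4 := adj.homEquiv_naturality_right ((adj.homEquiv S A).symm ψ₂) α.hom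
  exact h1.symm.trans (h3.trans (h4.trans (by rw [h2]; rfl)))

end Transport

/-! ### `Π/N` inside `B^temp(Π)`: morphisms to `Π/N₀` and the automorphism group -/

section Quotients

variable {G : Type u} [Group G] [TopologicalSpace G] [IsTopologicalGroup G]

/-- A morphism `Π/N → Π/N₀` in `B^temp(Π)` (`N`, `N₀` open normal) forces `N ≤ N₀`: the image
`g₀N₀` of the base point is fixed by `N`, and `Stab(g₀N₀) = N₀`.
[cite: MochizukiSemiAnbd2006, Rmk 3.1.3 p.34] -/
theorem le_of_hom_quotientObj (hG : IsTempered G) (N N₀ : OpenNormalSubgroup G)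
    (f : BTemp.quotientObj G hG N.toSubgroup N.isOpen' ⟶
      BTemp.quotientObj G hG N₀.toSubgroup N₀.isOpen') :
    N.toSubgroup ≤ N₀.toSubgroup := by
  intro n hn
  obtain ⟨g₀, hg₀⟩ := QuotientGroup.mk_surjective
    (f.hom.hom ((1 : G) : G ⧸ N.toSubgroup) : G ⧸ N₀.toSubgroup)
  have h1 : (BTemp.quotientObj G hG N.toSubgroup N.isOpen').obj.ρ n ((1 : G) : G ⧸ N.toSubgroup) =
      ((1 : G) : G ⧸ N.toSubgroup) := (quotientObj_ρ_one_eq_iff hG N.toSubgroup N.isOpen' n).mpr hn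
  have h2 := hom_ρ f n ((1 : G) : G ⧸ N.toSubgroup)
  rw [h1, ← hg₀, quotientObj_ρ_mk] at h2
  -- `h2 : g₀N₀ = (n g₀)N₀`
  have h3 : g₀⁻¹ * (n * g₀) ∈ N₀.toSubgroup := QuotientGroup.eq.mp h2
  have h4 := N₀.isNormal'.conj_mem _ h3 g₀
  simpa [mul_assoc] using h4

/-- **`Π/N ↪ Aut(Π/N)ᵒᵖ`** in `B^temp(Π)` (`N` open normal): if the automorphism group of the object
`Π/N` is residually finite then so is the group `Π/N`.  The embedding sends `cN` to the right
translation `xN ↦ xcN` (`exists_aut_quotientObj`), an anti-homomorphism with kernel `N`.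
[cite: MochizukiSemiAnbd2006, Rmk 3.1.3 p.34] -/
theorem residuallyFinite_quotient_of_aut (hG : IsTempered G) (N : OpenNormalSubgroup G)
    [Group.ResiduallyFinite (Aut (BTemp.quotientObj G hG N.toSubgroup N.isOpen'))] :
    Group.ResiduallyFinite (G ⧸ N.toSubgroup) := by
  classical
  haveI : N.toSubgroup.Normal := N.isNormal'
  let Q := BTemp.quotientObj G hG N.toSubgroup N.isOpen'
  have hQ : IsConnectedObj Q := isConnectedObj_quotientObj hG N.toSubgroup N.isOpen'
  -- the right translations
  let τ : G → Aut Q := fun c => Classical.choose (exists_aut_quotientObj hG N.toSubgroup N.isOpen' c)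
  have hτ : ∀ c : G,
      ((τ c).hom.hom.hom ((1 : G) : G ⧸ N.toSubgroup) : G ⧸ N.toSubgroup) = (c : G ⧸ N.toSubgroup) :=
    fun c => Classical.choose_spec (exists_aut_quotientObj hG N.toSubgroup N.isOpen' c)
  -- `τ` is an anti-homomorphism
  have hmul : ∀ c d : G, τ c * τ d = τ (d * c) := by
    intro c d
    apply Aut.ext
    refine hom_eq_of_apply_eq hQ _ _ ((1 : G) : G ⧸ N.toSubgroup) ?_
    change ((τ c).hom.hom.hom ((τ d).hom.hom.hom ((1 : G) : G ⧸ N.toSubgroup)) : G ⧸ N.toSubgroup) = _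
    rw [hτ d, hτ (d * c), ← quotientObj_ρ_one hG N.toSubgroup N.isOpen' d, hom_ρ, hτ c,
      quotientObj_ρ_mk]
  -- hence a homomorphism to the opposite group, with kernel `N`
  let φ : G →* (Aut Q)ᵐᵒᵖ :=
    { toFun := fun c => MulOpposite.op (τ c)
      map_one' := by
        rw [← MulOpposite.op_one]
        congr 1
        apply Aut.ext
        refine hom_eq_of_apply_eq hQ _ _ ((1 : G) : G ⧸ N.toSubgroup) ?_
        rw [hτ 1]
        rfl
      map_mul' := fun c d => by rw [← MulOpposite.op_mul, hmul] }
  have hker : φ.ker = N.toSubgroup := by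
    ext c
    rw [MonoidHom.mem_ker]
    constructor
    · intro h
      have h'' : MulOpposite.op (τ c) = MulOpposite.op 1 := by rw [MulOpposite.op_one]; exact h
      have h' : τ c = 1 := MulOpposite.op_injective h''
      have := hτ c
      rw [h'] at this
      change ((1 : G) : G ⧸ N.toSubgroup) = (c : G ⧸ N.toSubgroup) at this
      rw [QuotientGroup.eq] at this
      simpa using this
    · intro hc
      change MulOpposite.op (τ c) = 1
      rw [← MulOpposite.op_one]
      congr 1
      apply Aut.ext
      refine hom_eq_of_apply_eq hQ _ _ ((1 : G) : G ⧸ N.toSubgroup) ?_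
      rw [hτ c]
      change (c : G ⧸ N.toSubgroup) = ((1 : G) : G ⧸ N.toSubgroup)
      rw [QuotientGroup.eq]
      simpa using hc
  -- transfer residual finiteness: `(Aut Q)ᵐᵒᵖ` ⊇ range φ ≅ G/N
  haveI : Group.ResiduallyFinite (Aut Q)ᵐᵒᵖ := residuallyFinite_of_mulEquiv (MulEquiv.inv' (Aut Q))
  haveI : Group.ResiduallyFinite φ.range := inferInstance
  have e1 : G ⧸ N.toSubgroup ≃* φ.range :=
    (QuotientGroup.quotientMulEquivOfEq hker.symm).trans (QuotientGroup.quotientKerEquivRange φ)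
  exact residuallyFinite_of_mulEquiv e1.symm

end Quotients

/-! ### The reduction of Prop. 3.6 (iii) to Galois domination in `B^temp(𝒢)` -/

namespace ProfiniteSemiGraph

/-- **Cofinality of the residually-finite quotients from Galois domination**: for a chart `c` of
`π₁^temp(𝒢)`, if every connected object of `B^temp(𝒢)` receives a morphism from a Galois object
with residually finite automorphism group, then every open normal subgroup `N₀` of `c.G` contains an
open normal `N` with `c.G/N` residually finite. [cite: MochizukiSemiAnbd2006, Prop 3.6(iii) p.39] -/
theorem exists_le_residuallyFinite_quotient (𝒢 : ProfiniteSemiGraph.{u}) (c : TemperedPiChart 𝒢)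
    (hGal : ∀ S : BTempCat 𝒢, IsConnectedObj S →
      ∃ (H : BTempCat 𝒢) (_ : H ⟶ S), IsGaloisObj H ∧ Group.ResiduallyFinite (Aut H))
    (N₀ : OpenNormalSubgroup c.G) :
    ∃ N : OpenNormalSubgroup c.G,
      N.toSubgroup ≤ N₀.toSubgroup ∧ Group.ResiduallyFinite (c.G ⧸ N.toSubgroup) := by
  haveI := c.secondCountableTopology
  have hG := c.isTempered
  let e := c.equiv
  let X₀ : BTemp c.G := BTemp.quotientObj c.G hG N₀.toSubgroup N₀.isOpen'
  have hX₀ : IsConnectedObj X₀ := isConnectedObj_quotientObj hG N₀.toSubgroup N₀.isOpen'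
  -- the corresponding connected tempered covering of `𝒢`, and a Galois object over it
  have hS₀ : IsConnectedObj (e.inverse.obj X₀) := isConnectedObj_functor_obj e.symm hX₀
  obtain ⟨H, f, hH, hrf⟩ := hGal (e.inverse.obj X₀) hS₀
  -- back in `B^temp(c.G)`: a Galois object over `X₀`, hence some `c.G/N`
  have hY : IsGaloisObj (e.functor.obj H) := isGaloisObj_functor_obj e hH
  obtain ⟨N, ⟨iY⟩⟩ := exists_iso_quotientObj_of_isGaloisObj hG (e.functor.obj H) hY
  refine ⟨N, le_of_hom_quotientObj hG N N₀ (iY.inv ≫ e.functor.map f ≫ (e.counitIso.app X₀).hom), ?_⟩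
  -- `Aut H ≅ Aut (e H) ≅ Aut (c.G/N)` is residually finite
  haveI := hrf
  haveI : Group.ResiduallyFinite (Aut (e.functor.obj H)) :=
    residuallyFinite_of_mulEquiv (e.fullyFaithfulFunctor.autMulEquivOfFullyFaithful H)
  haveI : Group.ResiduallyFinite (Aut (BTemp.quotientObj c.G hG N.toSubgroup N.isOpen')) :=
    residuallyFinite_of_mulEquiv (Iso.conjAut iY)
  exact residuallyFinite_quotient_of_aut hG N

/-- **[SemiAnbd] Prop. 3.6 (iii) from Galois domination in `B^temp(𝒢)`** (p. 39): if, for every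
`𝒢` satisfying the hypotheses of Prop. 3.6, every connected tempered covering of `𝒢` receives a
morphism from a Galois object of `B^temp(𝒢)` with residually finite automorphism group [print: the
composite of a finite étale Galois covering and the universal graph-covering, whose deck group is an
extension of a finite group by a free group], then `TemperedPiResiduallyFinite` holds: every
tempered fundamental group of such a `𝒢` injects into its profinite completion.
[cite: MochizukiSemiAnbd2006, Prop 3.6(iii) p.39] -/
theorem temperedPiResiduallyFinite_of_galoisDomination
    (hGal : ∀ (𝒢 : ProfiniteSemiGraph.{u}), 𝒢.Prop36Hypotheses → ∀ S : BTempCat 𝒢,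
      IsConnectedObj S →
        ∃ (H : BTempCat 𝒢) (_ : H ⟶ S), IsGaloisObj H ∧ Group.ResiduallyFinite (Aut H)) :
    TemperedPiResiduallyFinite.{u} :=
  temperedPiResiduallyFinite_of_cofinal fun 𝒢 h𝒢 c N₀ =>
    exists_le_residuallyFinite_quotient 𝒢 c (hGal 𝒢 h𝒢) N₀

end ProfiniteSemiGraph

end Literature.AnabelianGeometry.SemiGraphs
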